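import Literature.AlgebraicGeometry.HodgeTheory.ArapuraSurfaceFibredFourfoldsProofs
import Literature.AlgebraicGeometry.HodgeTheory.GysinBaseChange
import Literature.AlgebraicGeometry.HodgeTheory.LefschetzOneOneHolds
import Literature.AlgebraicGeometry.HodgeTheory.ComplexConjugationHolds
import Literature.AlgebraicGeometry.HodgeTheory.ZariskiClosedNowhereDense
import Literature.AlgebraicGeometry.HodgeTheory.DivisorInduction
import Summits.HodgeConjecture.HodgeConjecture.Theorems.LimitExtensionMiddleDivisorSupportSuffices
import Summits.HodgeConjecture.HodgeConjecture.Theorems.LimitExtensionDivisorInduction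
import Summits.HodgeConjecture.HodgeConjecture.Theorems.SecondaryPeriodsHodgeImpliesConiveauOne
import Summits.HodgeConjecture.HodgeConjecture.Theorems.BoundaryReadoutPullbackAlgebraicCupDivisor
import HarnessLib

/-!
# Crux `K3TypeNets` (stmt-HodgeConjecture-11600), product-sector line: stub P1 `stub_pgZeroFactor`
# — the Hodge conjecture for `S₁ × S₂` with `p_g(S₂) = 0` (theorem in print, PROVED)

Route `HodgeConjecture/NoetherLefschetzOneUp`, crux `K3TypeNets` (stmt-HodgeConjecture-11600), published
line `product_sector` / piece `PgOneProductClasses` (crux workfiles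
`Cruxes/K3TypeNets/Lines/PgOneProductClasses_birth.lean`, `Lines/product_sector.lean`), stub P1
`stub_pgZeroFactor` — "THEOREM IN PRINT, folklore" (size L in the card): for smooth projective complex
surfaces `S₁`, `S₂` with `p_g(S₂) = 0` (rendered: a Hodge model `A` of `S₂` with `dim H^{2,0}(A) = 0`),
every rational `(2,2)`-class on `S₁ × S₂` (`S₁ ⊗ S₂` in `SchemeOver ℂ`) is algebraic. Proved here
UNCONDITIONALLY (no named-fact hypothesis, no `def`, no `sorry`), together with the full Hodge conjecture
`HodgeConjectureFor 4 (S₁ ⊗ S₂)` for such products, for EITHER factor of geometric genus zero.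

PROOF (a variant of the printed Künneth argument that avoids the Hodge types of Künneth components).
(1) **Every class of `H⁴((S₁ × S₂)(ℂ); ℂ)` is supported on a divisor** (`supportedClasses _ 4 1 = ⊤`):
by the Künneth theorem for the complex points of a product of smooth projective varieties (the tree's
PROVED `kunnethSpan_complexBetti`, Hatcher Thm. 3.16) a class is a combination of cross products
`pr₁^* b ∪ pr₂^* w`, `b ∈ Hⁱ(S₁)`, `w ∈ Hʲ(S₂)`, `i + j = 4`. If `j ≥ 3` then `w` dies off a proper
Zariski-closed subset of the surface `S₂` (`N¹Hʲ = Hʲ` above the dimension: Andreotti–Frankel for the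
affine complement of a hyperplane section, the tree's `mem_supportedClasses_one_of_dim_lt`); if `j ≤ 1`
then `i ≥ 3` and the same holds for `b` on `S₁`; if `i = j = 2` then — THE ONE PLACE WHERE `p_g = 0`
ENTERS — `H²(S₂(ℂ); ℂ) = H^{1,1}` is spanned by rational classes, which are divisor classes by the
Lefschetz `(1,1)` theorem (PROVED in the tree, `lefschetzOneOne_rational_holds`; the fibre step
`algebraicClasses_one_eq_top_of_pg_zero` of the tree's Arapura file), so `w ∈ N¹H²(S₂)`. Pull-back along
the (surjective) projections preserves `N¹` (`map_mem_supportedClasses_one_of_surjective`) and a cup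
product with an `N¹` class is `N¹` (restriction to a Zariski-open is multiplicative).
(2) **A rational `(2,2)`-class on a smooth projective fourfold supported on a divisor is algebraic**:
the CLOSED route item `NodalSupport.DivisorInduction` (`nodalSupport_divisorInduction_proof`: Deligne,
Hodge III 8.2.8 + semisimplicity + Hironaka, descent to the resolved components of the divisor) in
dimension `3 + 1` and codimension `2`, whose input — the Hodge conjecture in codimension `1` on smooth
projective threefolds — is Lefschetz `(1,1)`.
(3) All other codimensions on the fourfold `S₁ × S₂`: Lefschetz `(1,1)`, hard Lefschetz
(`nonempty_hardLefschetzNFold_holds`) and codimension `0` (`hodgeClasses_algebraic_fourfold_of_hodgeTwoTwo`);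
Hodge models exist (`nonempty_hodgeModel_holds`).

By the symmetry of step (1) the same holds with `p_g(S₁) = 0`. Examples covered: `S × E` for `S` any
smooth projective surface and `E` an Enriques, rational, ruled-over-`ℙ¹`… surface with `p_g = 0`
— in particular `K3 × Enriques`, `A × (rational surface)`, products of two `p_g = 0` surfaces of general
type (Godeaux, Campedelli, Burniat), where `CH₀` need not be representable, so this is not an instance
of the Bloch–Srinivas / Conte–Murre degree-four vacuity.

References: Voisin, *Hodge Theory and Complex Algebraic Geometry I*, Thm. 11.30 (Lefschetz `(1,1)`),
Thm. 11.38, Thm. 6.25; Hatcher, *Algebraic Topology*, Thm. 3.16; Grothendieck 1969 §1 (coniveau);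
Deligne, Hodge III, Cor. 8.2.8; Arapura 2022, proof of Cor. 1.5 (the `p_g = 0` fibre step).
-/

-- `Summit.HodgeConjecture.HodgeConjecture.Theorems` is the mandated namespace (single-conjunct summit:
-- Sub = Summit), which `linter.dupNamespace` flags; the lakefile turns the linter off tree-wide, restated
-- here so stand-alone elaboration is warning-free too.
set_option linter.dupNamespace false

noncomputable section

open CategoryTheory AlgebraicGeometry MonoidalCategory CartesianMonoidalCategory
open Literature.AlgebraicGeometry Literature.AlgebraicGeometry.Motives
open Literature.AlgebraicGeometry.HodgeTheory Literature.AlgebraicTopology.SingularHomology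

namespace Summit.HodgeConjecture.HodgeConjecture.Theorems

namespace PgOneProductClasses

/-! ### The second projection of a product is onto -/

/-- The second projection `Y ×_ℂ T ⟶ T` is surjective on the points of the underlying schemes as soon
as `Y` has a `ℂ`-point `y`: the slice `T ≅ {y} × T ⟶ Y × T` (pairing of the constant map through `y`
with the identity) is a section of it. Companion of the tree's `surjective_fst_left_base`. [folklore] -/
theorem surjective_snd_left_base {Y T : SchemeOver ℂ} (y : AlgPoints Y ℂ) :
    Function.Surjective (snd Y T).left.base := by
  intro t
  refine ⟨(CartesianMonoidalCategory.lift (toSpecOver T ≫ y) (𝟙 T)).left.base t, ?_⟩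
  have h := congrArg (fun f : T ⟶ T ↦ f.left.base t)
    (CartesianMonoidalCategory.lift_snd (toSpecOver T ≫ y) (𝟙 T))
  simp only [Over.comp_left, Scheme.Hom.comp_base, Over.id_left, Scheme.Hom.id_base,
    TopCat.comp_app, TopCat.id_app] at h
  exact h

/-! ### Step (1): on `S₁ × S₂` with a `p_g = 0` factor, all of `H⁴` is supported on a divisor -/

/-- **Cross products on a product of surfaces are supported on a divisor, granted `N¹H² = H²` on one
factor.** For smooth projective complex surfaces `S₁`, `S₂` such that the divisor classes span
`H²(S₁(ℂ); ℂ)` or span `H²(S₂(ℂ); ℂ)` (`algebraicClasses Sᵢ 1 = ⊤`), every class of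
`H⁴((S₁ × S₂)(ℂ); ℂ)` lies in `N¹H⁴`: Künneth (`kunnethSpan_complexBetti`) reduces to cross products
`pr₁^* b ∪ pr₂^* w` with `deg b + deg w = 4`; a factor of degree `≥ 3` on a surface is supported on a
divisor (`mem_supportedClasses_one_of_dim_lt`), and when both degrees are `2` the hypothesis applies to
one factor; pull-backs along the surjective projections and cup products preserve `N¹`.
[cite: HatcherAT2002, §3.2 Thm. 3.16] [cite: GrothendieckTopology1969, §1] -/
theorem supportedClasses_four_one_eq_top_of_algebraicClasses_one_eq_top {S₁ S₂ : SchemeOver ℂ}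
    (h₁ : IsSmoothProjective 2 S₁) (h₂ : IsSmoothProjective 2 S₂)
    (hN : algebraicClasses S₁ 1 = ⊤ ∨ algebraicClasses S₂ 1 = ⊤) :
    supportedClasses (S₁ ⊗ S₂) (2 * 2) 1 = ⊤ := by
  have hX : IsSmoothProjective (2 + 2) (S₁ ⊗ S₂) := IsSmoothProjective.tensor_holds h₁ h₂
  obtain ⟨y₁⟩ := nonempty_complexPoints h₁
  obtain ⟨y₂⟩ := nonempty_complexPoints h₂
  have hfst : Function.Surjective (fst S₁ S₂).left.base := surjective_fst_left_base y₂
  have hsnd : Function.Surjective (snd S₁ S₂).left.base := surjective_snd_left_base y₁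
  rw [eq_top_iff]
  intro z _
  refine (Submodule.span_le.mpr ?_) (kunnethSpan_complexBetti h₁ h₂ (2 * 2) z)
  rintro v ⟨i, j, hij, b, w, rfl⟩
  by_cases hj : 3 ≤ j
  · -- `w ∈ N¹Hʲ(S₂)` above the dimension of the surface `S₂`
    have hw : w ∈ supportedClasses S₂ j 1 := mem_supportedClasses_one_of_dim_lt h₂ (by omega) w
    exact cupProduct_mem_supportedClasses_right hij _
      (map_mem_supportedClasses_one_of_surjective hX h₂ (snd S₁ S₂) hsnd hw)
  by_cases hi : 3 ≤ i
  · -- `b ∈ N¹Hⁱ(S₁)` above the dimension of the surface `S₁`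
    have hb : b ∈ supportedClasses S₁ i 1 := mem_supportedClasses_one_of_dim_lt h₁ (by omega) b
    exact PullbackAlgebraicNormalCone.CupDivisor.cupProduct_mem_supportedClasses_left hij
      (map_mem_supportedClasses_one_of_surjective hX h₁ (fst S₁ S₂) hfst hb) _
  -- `i = j = 2`: the hypothesis on one of the factors
  obtain rfl : i = 2 := by omega
  obtain rfl : j = 2 := by omega
  rcases hN with hN₁ | hN₂
  · have hb : b ∈ supportedClasses S₁ (2 * 1) 1 := by
      change b ∈ algebraicClasses S₁ 1
      rw [hN₁]; exact Submodule.mem_top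
    exact PullbackAlgebraicNormalCone.CupDivisor.cupProduct_mem_supportedClasses_left hij
      (map_mem_supportedClasses_one_of_surjective hX h₁ (fst S₁ S₂) hfst hb) _
  · have hw : w ∈ supportedClasses S₂ (2 * 1) 1 := by
      change w ∈ algebraicClasses S₂ 1
      rw [hN₂]; exact Submodule.mem_top
    exact cupProduct_mem_supportedClasses_right hij _
      (map_mem_supportedClasses_one_of_surjective hX h₂ (snd S₁ S₂) hsnd hw)

/-- **On `S₁ × S₂` with `p_g(S₂) = 0` every class of `H⁴((S₁ × S₂)(ℂ); ℂ)` is supported on a divisor**: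
the divisor classes span `H²(S₂(ℂ); ℂ)` (the tree's fibre step `algebraicClasses_one_eq_top_of_pg_zero`:
`H^{2,0} = 0 = H^{0,2}`, so every class is of type `(1,1)`, rational classes span, and Lefschetz `(1,1)`
— PROVED, `lefschetzOneOne_rational_holds`), then
`supportedClasses_four_one_eq_top_of_algebraicClasses_one_eq_top`.
[cite: VoisinHodgeI2002, Thm. 11.30] [cite: Arapura2022, proof of Cor. 1.5 (p. 5)] -/
theorem supportedClasses_four_one_eq_top_of_pg_zero_right {S₁ S₂ : SchemeOver ℂ}
    (h₁ : IsSmoothProjective 2 S₁) (h₂ : IsSmoothProjective 2 S₂)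
    (hpg : ∃ A : HodgeModel 2 S₂, Module.finrank ℂ ↥(A.hodgePQ 2 2 0) = 0) :
    supportedClasses (S₁ ⊗ S₂) (2 * 2) 1 = ⊤ :=
  supportedClasses_four_one_eq_top_of_algebraicClasses_one_eq_top h₁ h₂
    (Or.inr (algebraicClasses_one_eq_top_of_pg_zero lefschetzOneOne_rational_holds h₂ hpg))

/-- The same with `p_g(S₁) = 0`. [cite: VoisinHodgeI2002, Thm. 11.30] -/
theorem supportedClasses_four_one_eq_top_of_pg_zero_left {S₁ S₂ : SchemeOver ℂ}
    (h₁ : IsSmoothProjective 2 S₁) (h₂ : IsSmoothProjective 2 S₂)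
    (hpg : ∃ A : HodgeModel 2 S₁, Module.finrank ℂ ↥(A.hodgePQ 2 2 0) = 0) :
    supportedClasses (S₁ ⊗ S₂) (2 * 2) 1 = ⊤ :=
  supportedClasses_four_one_eq_top_of_algebraicClasses_one_eq_top h₁ h₂
    (Or.inl (algebraicClasses_one_eq_top_of_pg_zero lefschetzOneOne_rational_holds h₁ hpg))

/-! ### Step (2): rational `(2,2)`-classes supported on a divisor of a fourfold are algebraic -/

/-- **A rational `(2,2)`-class on a smooth projective complex fourfold which is supported on a divisor
is algebraic**: the closed route item `NodalSupport.DivisorInduction` (descent to the resolved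
components of the divisor, Deligne Hodge III 8.2.8 with semisimplicity and Hironaka;
`nodalSupport_divisorInduction_proof`) in dimension `3 + 1`, codimension `2`, fed with the Hodge
conjecture in codimension `1` on smooth projective threefolds = Lefschetz `(1,1)`
(`lefschetzOneOne_rational_holds`). [cite: DeligneHodgeIII1974, Cor. 8.2.8]
[cite: VoisinHodgeI2002, Thm. 11.30] -/
theorem mem_algebraicClasses_two_of_mem_supportedClasses_one {X : SchemeOver ℂ}
    (hX : IsSmoothProjective 4 X) (c : complexBetti X (2 * 2)) (hc : IsRationalClass c)
    (hH : IsOfHodgeType 4 X (2 * 2) 2 2 c) (hN : c ∈ supportedClasses X (2 * 2) 1) :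
    c ∈ algebraicClasses X 2 :=
  nodalSupport_divisorInduction_proof 3 2 (by norm_num)
    (fun _ hY c' hc' hH' ↦ lefschetzOneOne_rational_holds hY c' hc' hH') hX c hc hH hN

/-! ### The stub, and the Hodge conjecture for the products -/

/-- **Stub P1 `stub_pgZeroFactor` of the product-sector line of crux `K3TypeNets`
(stmt-HodgeConjecture-11600), VERBATIM, proved unconditionally**: for smooth projective complex surfaces
`S₁`, `S₂` with `p_g(S₂) = 0` (a Hodge model of `S₂` with `dim H^{2,0} = 0`), every rational `(2,2)`-class
on `S₁ × S₂` is algebraic — all of `H⁴` is supported on a divisor (step (1)) and divisor-supported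
rational `(2,2)`-classes on a fourfold are algebraic (step (2)).
[cite: VoisinHodgeI2002, Thm. 11.30, Thm. 11.38 and Thm. 6.25] [cite: HatcherAT2002, §3.2 Thm. 3.16]
[cite: DeligneHodgeIII1974, Cor. 8.2.8] -/
theorem stub_pgZeroFactor :
    ∀ ⦃S₁ S₂ : SchemeOver ℂ⦄, IsSmoothProjective 2 S₁ → IsSmoothProjective 2 S₂ →
      (∃ A : HodgeModel 2 S₂, Module.finrank ℂ ↥(A.hodgePQ 2 2 0) = 0) →
      ∀ c : complexBetti (S₁ ⊗ S₂) (2 * 2), IsRationalClass c → IsOfHodgeType 4 (S₁ ⊗ S₂) (2 * 2) 2 2 c →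
        c ∈ algebraicClasses (S₁ ⊗ S₂) 2 := by
  intro S₁ S₂ h₁ h₂ hpg c hc hH
  have hX : IsSmoothProjective 4 (S₁ ⊗ S₂) := IsSmoothProjective.tensor_holds h₁ h₂
  refine mem_algebraicClasses_two_of_mem_supportedClasses_one hX c hc hH ?_
  rw [supportedClasses_four_one_eq_top_of_pg_zero_right h₁ h₂ hpg]
  exact Submodule.mem_top

/-- The mirror statement: `p_g(S₁) = 0` (first factor of geometric genus zero).
[cite: VoisinHodgeI2002, Thm. 11.30] [cite: DeligneHodgeIII1974, Cor. 8.2.8] -/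
theorem hodgeTwoTwo_algebraic_prod_of_pg_zero_left
    ⦃S₁ S₂ : SchemeOver ℂ⦄ (h₁ : IsSmoothProjective 2 S₁) (h₂ : IsSmoothProjective 2 S₂)
    (hpg : ∃ A : HodgeModel 2 S₁, Module.finrank ℂ ↥(A.hodgePQ 2 2 0) = 0)
    (c : complexBetti (S₁ ⊗ S₂) (2 * 2)) (hc : IsRationalClass c)
    (hH : IsOfHodgeType 4 (S₁ ⊗ S₂) (2 * 2) 2 2 c) : c ∈ algebraicClasses (S₁ ⊗ S₂) 2 := by
  have hX : IsSmoothProjective 4 (S₁ ⊗ S₂) := IsSmoothProjective.tensor_holds h₁ h₂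
  refine mem_algebraicClasses_two_of_mem_supportedClasses_one hX c hc hH ?_
  rw [supportedClasses_four_one_eq_top_of_pg_zero_left h₁ h₂ hpg]
  exact Submodule.mem_top

/-- **The Hodge conjecture for `S₁ × S₂`, `S₁`, `S₂` smooth projective complex surfaces with
`p_g(S₂) = 0`** (e.g. `K3 × Enriques`, `S × (rational or ruled surface)`, `S × (Godeaux/Campedelli/Burniat
surface)`), in every codimension, in the summit's spelling `HodgeConjectureFor 4 (S₁ ⊗ S₂)`: codimension
`2` is `stub_pgZeroFactor`; codimensions `0, 1, 3, 4` by Lefschetz `(1,1)` and hard Lefschetz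
(`hodgeClasses_algebraic_fourfold_of_hodgeTwoTwo` with `lefschetzOneOne_rational_holds`,
`nonempty_hardLefschetzNFold_holds`); a Hodge model exists (`nonempty_hodgeModel_holds`).
[cite: VoisinHodgeI2002, Thm. 11.30 and Thm. 6.25] [cite: Murre1977, Remark 1 (p. 230)] -/
theorem hodgeConjectureFor_prod_of_pg_zero_right ⦃S₁ S₂ : SchemeOver ℂ⦄
    (h₁ : IsSmoothProjective 2 S₁) (h₂ : IsSmoothProjective 2 S₂)
    (hpg : ∃ A : HodgeModel 2 S₂, Module.finrank ℂ ↥(A.hodgePQ 2 2 0) = 0) :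
    HodgeConjectureFor 4 (S₁ ⊗ S₂) := by
  have hX : IsSmoothProjective 4 (S₁ ⊗ S₂) := IsSmoothProjective.tensor_holds h₁ h₂
  exact ⟨nonempty_hodgeModel_holds hX, fun p c hc hH ↦
    hodgeClasses_algebraic_fourfold_of_hodgeTwoTwo lefschetzOneOne_rational_holds
      (nonempty_hardLefschetzNFold_holds 4 (S₁ ⊗ S₂)) hX (stub_pgZeroFactor h₁ h₂ hpg) p c hc hH⟩

/-- **The Hodge conjecture for `S₁ × S₂` with `p_g(S₁) = 0`** (mirror of
`hodgeConjectureFor_prod_of_pg_zero_right`). [cite: VoisinHodgeI2002, Thm. 11.30 and Thm. 6.25] -/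
theorem hodgeConjectureFor_prod_of_pg_zero_left ⦃S₁ S₂ : SchemeOver ℂ⦄
    (h₁ : IsSmoothProjective 2 S₁) (h₂ : IsSmoothProjective 2 S₂)
    (hpg : ∃ A : HodgeModel 2 S₁, Module.finrank ℂ ↥(A.hodgePQ 2 2 0) = 0) :
    HodgeConjectureFor 4 (S₁ ⊗ S₂) := by
  have hX : IsSmoothProjective 4 (S₁ ⊗ S₂) := IsSmoothProjective.tensor_holds h₁ h₂
  exact ⟨nonempty_hodgeModel_holds hX, fun p c hc hH ↦
    hodgeClasses_algebraic_fourfold_of_hodgeTwoTwo lefschetzOneOne_rational_holds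
      (nonempty_hardLefschetzNFold_holds 4 (S₁ ⊗ S₂)) hX
      (hodgeTwoTwo_algebraic_prod_of_pg_zero_left h₁ h₂ hpg) p c hc hH⟩

end PgOneProductClasses

end Summit.HodgeConjecture.HodgeConjecture.Theorems

end
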